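import Literature.NumberTheory.DiophantineGeometry.AbelianSchemeModelReductionNaturality
import HarnessLib

/-!
# The reduction map of points of a PROPER integral model (no group structure): `X(K̄_v) → 𝒳_v(κ̄(v))`, and its naturality
# ([SerreTate1968] §1 «the reduction map»; [Hartshorne1977] II.4.7 valuative criterion)

Topic `Literature/AlgebraicGeometry/Motives`, namespace `Literature.AlgebraicGeometry.Motives.IntegralModel`.  Choice-free DEFINITIONS +
theorems; NO named fact, no instance, no notation, no `sorry`.  Cell `hodgecm-mathlib` (D-0151), FLOOR 0, programme F0P5a (D9op road 2′,
crux item stmt-HodgeConjecture-24832): piece **D1 + C2a** of the C2 package (planner ED4-CUT-LETTER v0 §1; census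
`F0/P5a/C2-PACKAGE-census.v0.F0P5a-p02g0.md`): the reduction map for the smooth proper model `𝒮` (and `𝒮 ⊗ 𝒮`) of the record CURVE, which
carries no group law — the tree's ★ `AbelianVariety.GoodReductionAt.geomReductionMap` (`AbelianVarietyGoodReductionReductionMap.lean`) is the
same construction for the model of an abelian variety, and we follow it line by line, dropping the reduction isomorphism (for a bare
`IntegralModel 𝓞ᵥ K X` the special fibre IS `𝒳.reductionAt = (specialFibreFunctor v).obj 𝒳.total`, ★ `specialFibreFunctor_obj_eq_reductionAt`).

Base: `R = closureValuationSubring (v.adicCompletion K) ⊆ Ω = \overline{K_v}` with `f = toClosureValuationSubring v : 𝓞ᵥ → R` — the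
★-complete base of the tree (isos ★ `specFractionFieldIso v`, ★ `geomClosedPointIso v`, ★ `geomClosedPointIsoSpecResidueField v`; residue
field read as `geomResidueField v = κ̄(v)`).

* `IntegralModel.modelPointsEquiv 𝒳 : Hom_{𝓞ᵥ}(Spec Ω, 𝒳) ≃ X(Ω)` (adjunction `Over.map ⊣ Over.pullback` + the model's OWN `genericIso`);
* `IntegralModel.reductionPoint 𝒳 : 𝒳(κ(R)) → 𝒳_v(κ̄(v))` (adjunction at the closed point);
* **`IntegralModel.geomReductionMap 𝒳 : X(Ω) → 𝒳_v(κ̄(v))`** for `𝒳` PROPER: `modelPointsEquiv⁻¹`, extension to an `R`-point (★ `extendPoint`,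
  valuative criterion), specialisation, `reductionPoint` — a plain function;
* **C2a `IntegralModel.geomReductionMap_map`** — naturality in a model morphism `𝔣 : 𝒳 ⟶ 𝒴` with prescribed generic fibre `f : X ⟶ Y`:
  `red_𝒴 (f x) = 𝔣_v (red_𝒳 x)` (★ `extendPoint_comp_hom`, uniqueness in the valuative criterion) — in particular for the two projections
  of `𝒮 ⊗ 𝒮` (C2a′ is this lemma at `𝔣 := fst, snd`) and for the Néron extension `𝔞 : 𝒮 ⊗ 𝒮 ⟶ 𝒜` followed by ★
  `IsAbelianSchemeModel.geomReductionMap_goodReductionAt` on the abelian side.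

HC_CM is proved only modulo the 7 printed citations until rung 0 closes; this file is a generic leaf and changes no count.

## References
* [SerreTate1968] J.-P. Serre, J. Tate, *Good reduction of abelian varieties*, Ann. of Math. 88 (1968), §1.
* [Hartshorne1977] R. Hartshorne, *Algebraic Geometry*, II.4.7 (valuative criterion), II.3 Thm. 3.3 (fibre products).
-/

set_option autoImplicit false

noncomputable section

open CategoryTheory AlgebraicGeometry IsDedekindDomain IsDedekindDomain.HeightOneSpectrum
open scoped NumberField
open Literature.NumberTheory.EllipticCurves (genericFibre specGenericPoint)
open Literature.NumberTheory.GaloisRepresentations (closureValuationSubring)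
open Literature.NumberTheory.DiophantineGeometry

namespace Literature.AlgebraicGeometry.Motives

namespace IntegralModel

variable {K : Type} [Field K] [NumberField K] {v : HeightOneSpectrum (𝓞 K)} {X Y : SchemeOver K}

/-- The generic isomorphism of an integral model RETYPED at the generic-fibre functor: `𝒳 ×_{𝓞ᵥ} K ≅ X` (`Motives.baseChange 𝓞ᵥ K` is
`genericFibre 𝓞ᵥ K` by `rfl`). [cite: SerreTate1968, §1] -/
def genericIso' (𝒳 : IntegralModel (valuationSubringAtPrime K v) K X) :
    (genericFibre (valuationSubringAtPrime K v) K).obj 𝒳.total ≅ X :=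
  𝒳.genericIso

/-- **`Hom_{𝓞ᵥ}(Spec Ω, 𝒳) ≃ X(Ω)`** (`Ω = \overline{K_v}`) for an integral model `𝒳` of `X`: an `Ω`-point of the total space over `𝓞ᵥ` is an `Ω`-point
of the generic fibre (adjunction `Over.map ⊣ Over.pullback`), read in `X` through the model's OWN `genericIso`.
[cite: Hartshorne1977, II.3 Thm. 3.3 (fibre product, universal property)] -/
def modelPointsEquiv (𝒳 : IntegralModel (valuationSubringAtPrime K v) K X) :
    (specFractionField (closureValuationSubring (v.adicCompletion K)) (toClosureValuationSubring v) ⟶ 𝒳.total) ≃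
      AlgPoints X (AlgebraicClosure (v.adicCompletion K)) :=
  ((specFractionFieldIso v).homCongr (Iso.refl 𝒳.total)).trans
    (((Over.mapPullbackAdj (specGenericPoint (valuationSubringAtPrime K v) K)).homEquiv _ 𝒳.total).trans
      ((Iso.refl _).homCongr 𝒳.genericIso'))

/-- Unfolding `modelPointsEquiv`: adjoint of `e⁻¹ ≫ P`, followed by `𝒳.genericIso`. [cite: Hartshorne1977, II.3 Thm. 3.3 (fibre product, universal property)] -/
theorem modelPointsEquiv_apply (𝒳 : IntegralModel (valuationSubringAtPrime K v) K X)
    (P : specFractionField (closureValuationSubring (v.adicCompletion K)) (toClosureValuationSubring v) ⟶ 𝒳.total) :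
    𝒳.modelPointsEquiv P =
      (Over.mapPullbackAdj (specGenericPoint (valuationSubringAtPrime K v) K)).homEquiv _ 𝒳.total
          ((specFractionFieldIso v).inv ≫ P) ≫ 𝒳.genericIso'.hom := by
  change (Iso.refl _).inv ≫ (Over.mapPullbackAdj (specGenericPoint (valuationSubringAtPrime K v) K)).homEquiv _
    𝒳.total ((specFractionFieldIso v).inv ≫ P ≫ (Iso.refl 𝒳.total).hom) ≫ 𝒳.genericIso'.hom = _
  rw [Iso.refl_hom, Iso.refl_inv, Category.comp_id, Category.id_comp]

/-- **`𝒳(κ(R)) → 𝒳_v(κ̄(v))`**: a `κ(R)`-point of the total space (re-based to the abstract `κ̄(v)` along ★ `geomClosedPointIsoSpecResidueField`) is a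
`κ̄(v)`-point of the special fibre `𝒳_v = 𝒳.reductionAt` (adjunction at the closed point `Spec κ(v) → Spec 𝓞ᵥ`). No reduction isomorphism: for a bare
integral model the special fibre IS `𝒳.reductionAt`. [cite: Hartshorne1977, II.3 Thm. 3.3 (fibre product, universal property)] -/
def reductionPoint (𝒳 : IntegralModel (valuationSubringAtPrime K v) K X) (y : residueFieldPoints 𝒳.total) :
    AlgPoints 𝒳.reductionAt (geomResidueField v) :=
  (Over.mapPullbackAdj (specResidueField v)).homEquiv _ 𝒳.total
      ((geomClosedPointIso v).inv ≫ (geomClosedPointIsoSpecResidueField v).inv ≫ y)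

/-- **The reduction map `red_𝒳 : X(Ω) → 𝒳_v(κ̄(v))` of a PROPER integral model** ([SerreTate1968] §1): `X(Ω) ≃ 𝒳(Ω)` (`modelPointsEquiv⁻¹`),
extension to an `R`-point by the valuative criterion of properness (★ `extendPoint`), specialisation to `κ(R)`, and `reductionPoint`.  A plain
function: NO group structure on the model is assumed (the case of the smooth proper model of a curve).
[cite: SerreTate1968, §1] [cite: Hartshorne1977, II.4.7] -/
def geomReductionMap (𝒳 : IntegralModel (valuationSubringAtPrime K v) K X) [IsProper 𝒳.total.hom]
    (x : AlgPoints X (AlgebraicClosure (v.adicCompletion K))) : AlgPoints 𝒳.reductionAt (geomResidueField v) :=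
  𝒳.reductionPoint
    (specRingHomι (closureValuationSubring (v.adicCompletion K)) (toClosureValuationSubring v)
        (IsLocalRing.residue (closureValuationSubring (v.adicCompletion K))) ≫
      extendPoint (closureValuationSubring (v.adicCompletion K)) (toClosureValuationSubring v) 𝒳.total
        (𝒳.modelPointsEquiv.symm x))

/-- Unfolding `geomReductionMap`. [cite: SerreTate1968, §1] -/
theorem geomReductionMap_def (𝒳 : IntegralModel (valuationSubringAtPrime K v) K X) [IsProper 𝒳.total.hom]
    (x : AlgPoints X (AlgebraicClosure (v.adicCompletion K))) :
    𝒳.geomReductionMap x = 𝒳.reductionPoint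
      (specRingHomι (closureValuationSubring (v.adicCompletion K)) (toClosureValuationSubring v)
          (IsLocalRing.residue (closureValuationSubring (v.adicCompletion K))) ≫
        extendPoint (closureValuationSubring (v.adicCompletion K)) (toClosureValuationSubring v) 𝒳.total
          (𝒳.modelPointsEquiv.symm x)) := rfl

/-! ### C2a: naturality in a model morphism with prescribed generic fibre -/

/-- **`modelPointsEquiv` is natural**: for `𝔣 : 𝒳 ⟶ 𝒴` over `𝓞ᵥ` whose generic fibre is `f : X ⟶ Y` (`𝔣_K ≫ e_𝒴 = e_𝒳 ≫ f`),
`e_𝒴 (P ≫ 𝔣) = e_𝒳(P) ≫ f`. [cite: Hartshorne1977, II.3 Thm. 3.3 (fibre product, universal property)] -/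
theorem modelPointsEquiv_comp (𝒳 : IntegralModel (valuationSubringAtPrime K v) K X) (𝒴 : IntegralModel (valuationSubringAtPrime K v) K Y)
    (𝔣 : 𝒳.total ⟶ 𝒴.total) (f : X ⟶ Y)
    (hf : (genericFibre (valuationSubringAtPrime K v) K).map 𝔣 ≫ 𝒴.genericIso'.hom = 𝒳.genericIso'.hom ≫ f)
    (P : specFractionField (closureValuationSubring (v.adicCompletion K)) (toClosureValuationSubring v) ⟶ 𝒳.total) :
    𝒴.modelPointsEquiv (P ≫ 𝔣) = AlgPoints.map f (𝒳.modelPointsEquiv P) := by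
  rw [𝒴.modelPointsEquiv_apply, 𝒳.modelPointsEquiv_apply, AlgPoints.map_apply,
    ← Category.assoc (specFractionFieldIso v).inv P 𝔣, Adjunction.homEquiv_naturality_right, Category.assoc, Category.assoc]
  congr 1

/-- The inverse form: `e_𝒴⁻¹ (f Q) = e_𝒳⁻¹(Q) ≫ 𝔣`. [cite: Hartshorne1977, II.3 Thm. 3.3 (fibre product, universal property)] -/
theorem modelPointsEquiv_symm_map (𝒳 : IntegralModel (valuationSubringAtPrime K v) K X) (𝒴 : IntegralModel (valuationSubringAtPrime K v) K Y)
    (𝔣 : 𝒳.total ⟶ 𝒴.total) (f : X ⟶ Y)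
    (hf : (genericFibre (valuationSubringAtPrime K v) K).map 𝔣 ≫ 𝒴.genericIso'.hom = 𝒳.genericIso'.hom ≫ f)
    (Q : AlgPoints X (AlgebraicClosure (v.adicCompletion K))) :
    𝒴.modelPointsEquiv.symm (AlgPoints.map f Q) = 𝒳.modelPointsEquiv.symm Q ≫ 𝔣 := by
  apply 𝒴.modelPointsEquiv.injective
  rw [Equiv.apply_symm_apply, modelPointsEquiv_comp 𝒳 𝒴 𝔣 f hf, Equiv.apply_symm_apply]

/-- **`reductionPoint` is natural**: `r_𝒴 (y ≫ 𝔣) = 𝔣_v (r_𝒳 y)` (adjunction naturality; `𝔣_v = (specialFibreFunctor v).map 𝔣`).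
[cite: Hartshorne1977, II.3 Thm. 3.3 (fibre product, universal property)] -/
theorem reductionPoint_comp (𝒳 : IntegralModel (valuationSubringAtPrime K v) K X) (𝒴 : IntegralModel (valuationSubringAtPrime K v) K Y)
    (𝔣 : 𝒳.total ⟶ 𝒴.total) (y : residueFieldPoints 𝒳.total) :
    𝒴.reductionPoint (y ≫ 𝔣) = AlgPoints.map ((specialFibreFunctor v).map 𝔣) (𝒳.reductionPoint y) := by
  rw [reductionPoint, reductionPoint, AlgPoints.map_apply, ← Category.assoc (geomClosedPointIsoSpecResidueField v).inv,
    ← Category.assoc (geomClosedPointIso v).inv, Adjunction.homEquiv_naturality_right]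

/-- **C2a — the reduction map is natural in the model morphism** ([SerreTate1968] §1; valuative criterion, uniqueness half): for PROPER
integral models `𝒳`, `𝒴` of `X`, `Y` at `v` and an `𝓞ᵥ`-morphism `𝔣 : 𝒳 ⟶ 𝒴` whose generic fibre is `f : X ⟶ Y`,
`red_𝒴 (f x) = 𝔣_v (red_𝒳 x)` for every `x ∈ X(Ω)`.  Use (F0P5a ED4 §4): `𝔣 := fst, snd` on `𝒮 ⊗ 𝒮` (C2a′: the reduction of a pair is the
pair of reductions) and `𝔣 := 𝔞 : 𝒮 ⊗ 𝒮 ⟶ 𝒜` (the Néron extension of `αd`, ★ p792757), followed by ★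
`IsAbelianSchemeModel.geomReductionMap_goodReductionAt` on the abelian side. [cite: SerreTate1968, §1] [cite: Hartshorne1977, II.4.7] -/
theorem geomReductionMap_map (𝒳 : IntegralModel (valuationSubringAtPrime K v) K X) (𝒴 : IntegralModel (valuationSubringAtPrime K v) K Y)
    [IsProper 𝒳.total.hom] [IsProper 𝒴.total.hom] (𝔣 : 𝒳.total ⟶ 𝒴.total) (f : X ⟶ Y)
    (hf : (genericFibre (valuationSubringAtPrime K v) K).map 𝔣 ≫ 𝒴.genericIso'.hom = 𝒳.genericIso'.hom ≫ f)
    (x : AlgPoints X (AlgebraicClosure (v.adicCompletion K))) :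
    𝒴.geomReductionMap (AlgPoints.map f x) = AlgPoints.map ((specialFibreFunctor v).map 𝔣) (𝒳.geomReductionMap x) := by
  rw [geomReductionMap_def, geomReductionMap_def, modelPointsEquiv_symm_map 𝒳 𝒴 𝔣 f hf, extendPoint_comp_hom, ← Category.assoc,
    reductionPoint_comp]

end IntegralModel

end Literature.AlgebraicGeometry.Motives

end
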